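import Summits.Ventures.DiscreteObjects.Hadamard.Order167CentralizerQuaternion668

/-!
# H(668): maximal centraliser of an element of order 167 (index 4) ⇒ H is a V₄-twisted array of FOUR circulant blocks —
# the Williamson-type shape (kernel dictionary)

Framing: lottery ticket; floor = certified bounds/negative ranges.

Cell pub-namedobj (venture DiscreteObjects), target (H), hadamard gen 21.  By `Order167CentralizerFree668` /
`Order167CentralizerQuaternion668` the centraliser of a signed automorphism `σ = (π, κ, d, e)` of pair order `167` of a
Hadamard matrix `H` of order `668` has index `1, 2` or `4` over `±⟨σ⟩`, index `4` meaning: two signed automorphisms `τ₁, τ₂`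
commuting with `σ` whose permutation pairs are DISTINCT non-trivial involutions (then `τ₁, τ₂, τ₁τ₂` are nega, pairwise
commuting as pairs, anticommuting as signed maps: `Q₈`).  Here the matrix is identified:
* `signedAut_resign'`, `signs_const_of_commute`: a signed automorphism commuting with `σ` acts on the re-signed matrix `H'`
  (on which `σ` is a permutation automorphism, `ResignOddOrder`) with signs CONSTANT along the `σ`-orbits (λ-argument of gen 20,
  here for `μ = 1`).
* **`exists_williamsonTypeArray_of_centralizer_index_four`**: label `V = ℤ/2 × ℤ/2 = {0, a, b, a+b}` and
  `P_g = π₁^{g₁} π₂^{g₂}`, `Q_g = κ₁^{g₁} κ₂^{g₂}`; the maps `(g, s) ↦ π^s (P_g x₀)` and `(h, t) ↦ κ^t (Q_h y₀)` are BIJECTIONS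
  `V × ℤ/167 ≃ rows, columns` (the pair group `⟨σ⟩ × V` acts regularly: freeness + at most four classes), and in these
  coordinates `H' ((g,s),(h,t)) = θ(g,h) · A_{g+h}(t − s)` with a `±1` table `θ : V × V → {±1}` and FOUR `±1` sequences
  `A_k : ℤ/167 → {±1}` (`A_k(r) = H'(x₀, κ^r Q_k y₀)`).  So: **if the centraliser of an element of order 167 of Aut± H(668) has
  index 4 over `±⟨σ⟩`, then `H` is equivalent to a Hadamard matrix of the form `[θ(g,h) A_{g+h}]_{g,h ∈ V₄}` — the `4 × 4`
  WILLIAMSON-TYPE arrangement `(A B C D / B A D C / C D A B / D C B A)` of four circulant blocks of order `167`, up to the sign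
  table `θ`** (conversely the classical Williamson array with circulant `A, B, C, D` is of this form and carries `σ` and the
  quaternion symmetries).  With gen 19 (`order 167 ⇔ 16 circulant blocks`; `order 334 ⇔ 2 × 2 negacyclic array`) this completes
  the `167`-local dictionary: index `1` — sixteen circulant blocks; index `≥ 2` — an element of pair order `334` (`τσ`), Ito type;
  index `4` — four circulant blocks in Williamson-type arrangement.
DICTIONARY / STRUCTURE of a hypothetical object; no existence claim; H(668) untouched; HITS 0/4.  Ours (the cocyclic reading —
`Q₈ × C₁₆₇` centrally regular — is de Launey–Flannery–Horadam's framework, status remark only); no `sorry`, no definitions (the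
array is a `Matrix.of` term), default heartbeats.
-/

namespace Summit.Ventures.DiscreteObjects.Hadamard

open Finset BigOperators Matrix

open Literature.Combinatorics.Designs.GoethalsSeidel (IsHadamardMatrix)

variable {ι : Type*} [Fintype ι] [DecidableEq ι]

/-! ### tools: re-signing a signed automorphism; sign constancy along orbits -/

omit [Fintype ι] [DecidableEq ι] in
/-- a signed automorphism of `H` is a signed automorphism of the re-signed matrix `H' i j = s i * t j * H i j`
(adapted from `Order167InvertingNormalizer668`) -/
lemma signedAut_resign' {H : Matrix ι ι ℤ} {s t : ι → ℤ} (hs : ∀ i, s i = 1 ∨ s i = -1) (ht : ∀ j, t j = 1 ∨ t j = -1)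
    {P Q : Equiv.Perm ι} {D E : ι → ℤ} (hA : IsSignedAut H P Q D E) :
    IsSignedAut (Matrix.of fun i j => s i * t j * H i j) P Q (fun i => s (P i) * s i * D i)
      (fun j => t (Q j) * t j * E j) := by
  refine ⟨fun i => ?_, fun j => ?_, fun i j => ?_⟩
  · rcases hs (P i) with h1 | h1 <;> rcases hs i with h2 | h2 <;> rcases hA.1 i with h3 | h3 <;> simp [h1, h2, h3]
  · rcases ht (Q j) with h1 | h1 <;> rcases ht j with h2 | h2 <;> rcases hA.2.1 j with h3 | h3 <;> simp [h1, h2, h3]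
  · simp only [Matrix.of_apply]
    rw [hA.2.2 i j]
    have h1 := pm_mul_self (hs i); have h2 := pm_mul_self (ht j)
    calc s (P i) * t (Q j) * (D i * E j * H i j)
        = s (P i) * t (Q j) * (D i * E j * H i j) * ((s i * s i) * (t j * t j)) := by rw [h1, h2]; ring
      _ = s (P i) * s i * D i * (t (Q j) * t j * E j) * (s i * t j * H i j) := by ring

omit [Fintype ι] [DecidableEq ι] in
/-- **sign constancy (λ-argument, commuting case).**  If `(π, κ)` is a permutation automorphism of a matrix `H'` with non-zero
entries, `π ^ p = 1` with `p` odd, and `(P, Q, D, E)` is a signed automorphism of `H'` whose parts commute with `π`, `κ`, then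
`D` is constant along `π`-orbits and `E` along `κ`-orbits. -/
lemma signs_const_of_commute {H' : Matrix ι ι ℤ} (hne0 : ∀ i j, H' i j ≠ 0) {π κ P Q : Equiv.Perm ι} {D E : ι → ℤ}
    (hinv : ∀ i j, H' (π i) (κ j) = H' i j) {p : ℕ} (hodd : Odd p) (hπ : π ^ p = 1)
    (hτ : IsSignedAut H' P Q D E) (hcP : Commute P π) (hcQ : Commute Q κ) (x₀ : ι) :
    (∀ k x, D ((π ^ k) x) = D x) ∧ (∀ k y, E ((κ ^ k) y) = E y) := by
  obtain ⟨hD, hE, hτ⟩ := hτ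
  have key : ∀ x y, D (π x) * E (κ y) * H' x y = D x * E y * H' x y := by
    intro x y
    have h1 : H' (P (π x)) (Q (κ y)) = D (π x) * E (κ y) * H' x y := by rw [hτ, hinv]
    have h2 : P (π x) = π (P x) := by rw [← Equiv.Perm.mul_apply, hcP.eq, Equiv.Perm.mul_apply]
    have h3 : Q (κ y) = κ (Q y) := by rw [← Equiv.Perm.mul_apply, hcQ.eq, Equiv.Perm.mul_apply]
    rw [h2, h3, hinv, hτ] at h1
    exact h1.symm
  have hlam : ∀ x, D (π x) = (E x₀ * E (κ x₀)) * D x := by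
    intro x
    have h := key x x₀
    have h2 : D (π x) * E (κ x₀) = D x * E x₀ := by
      have : (D (π x) * E (κ x₀) - D x * E x₀) * H' x x₀ = 0 := by linarith
      rcases mul_eq_zero.mp this with h0 | h0
      · linarith
      · exact (hne0 x x₀ h0).elim
    calc D (π x) = D (π x) * (E (κ x₀) * E (κ x₀)) := by rw [pm_mul_self (hE _), mul_one]
      _ = (D (π x) * E (κ x₀)) * E (κ x₀) := by ring
      _ = (E x₀ * E (κ x₀)) * D x := by rw [h2]; ring
  have hlampm : E x₀ * E (κ x₀) = 1 ∨ E x₀ * E (κ x₀) = -1 := by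
    rcases hE x₀ with h1 | h1 <;> rcases hE (κ x₀) with h2 | h2 <;> simp [h1, h2]
  have hlampow : ∀ k x, D ((π ^ k) x) = (E x₀ * E (κ x₀)) ^ k * D x := by
    intro k; induction k with
    | zero => intro x; simp
    | succ k ih => intro x; rw [pow_succ', Equiv.Perm.mul_apply, hlam, ih, pow_succ]; ring
  have hlam1 : E x₀ * E (κ x₀) = 1 := by
    rcases hlampm with h | h
    · exact h
    · exfalso
      have h1 := hlampow p x₀
      rw [hπ, Equiv.Perm.one_apply, h, Odd.neg_one_pow hodd] at h1
      exact pm_ne_zero (hD x₀) (by linarith)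
  have hdπ : ∀ x, D (π x) = D x := fun x => by rw [hlam, hlam1, one_mul]
  have heκ : ∀ y, E (κ y) = E y := by
    intro y
    have h := key x₀ y
    rw [hdπ] at h
    have hne : D x₀ * H' x₀ y ≠ 0 := mul_ne_zero (pm_ne_zero (hD x₀)) (hne0 x₀ y)
    have : (E (κ y) - E y) * (D x₀ * H' x₀ y) = 0 := by linarith
    rcases mul_eq_zero.mp this with h0 | h0
    · linarith
    · exact (hne h0).elim
  refine ⟨fun k => ?_, fun k => ?_⟩
  · induction k with
    | zero => intro x; simp
    | succ k ih => intro x; rw [pow_succ', Equiv.Perm.mul_apply, hdπ, ih]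
  · induction k with
    | zero => intro y; simp
    | succ k ih => intro y; rw [pow_succ', Equiv.Perm.mul_apply, heκ, ih]

/-! ### the Klein four-group labelling -/

/-- arithmetic of `V₄ = ℤ/2 × ℤ/2` used below -/
lemma v4_facts : (∀ g : ZMod 2 × ZMod 2, g + g = 0) ∧ (∀ g h : ZMod 2 × ZMod 2, g + (g + h) = h) ∧
    (∀ g h : ZMod 2 × ZMod 2, g + h = 0 → g = h) ∧
    (∀ g : ZMod 2 × ZMod 2, g ≠ 0 → (g.1.val = 1 ∧ g.2.val = 0) ∨ (g.1.val = 0 ∧ g.2.val = 1) ∨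
      (g.1.val = 1 ∧ g.2.val = 1)) := by
  refine ⟨by decide, by decide, by decide, by decide⟩

omit [Fintype ι] [DecidableEq ι] in
/-- the labelling `g ↦ α^{g₁} β^{g₂}` of commuting involutions (or trivial maps) `α, β` is a homomorphism from `V₄` -/
lemma v4_label_add {α β : Equiv.Perm ι} (hα : α ^ 2 = 1) (hβ : β ^ 2 = 1) (hc : Commute α β) (g h : ZMod 2 × ZMod 2) :
    α ^ (g + h).1.val * β ^ (g + h).2.val = (α ^ g.1.val * β ^ g.2.val) * (α ^ h.1.val * β ^ h.2.val) := by
  rw [Prod.fst_add, Prod.snd_add, ZMod.val_add, ZMod.val_add, pow_mod_of_pow_eq_one α hα, pow_mod_of_pow_eq_one β hβ,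
    pow_add, pow_add]
  have h1 : Commute (α ^ h.1.val) (β ^ g.2.val) := (hc.pow_pow _ _)
  calc α ^ g.1.val * α ^ h.1.val * (β ^ g.2.val * β ^ h.2.val)
      = α ^ g.1.val * (α ^ h.1.val * β ^ g.2.val) * β ^ h.2.val := by simp only [mul_assoc]
    _ = α ^ g.1.val * (β ^ g.2.val * α ^ h.1.val) * β ^ h.2.val := by rw [h1.eq]
    _ = α ^ g.1.val * β ^ g.2.val * (α ^ h.1.val * β ^ h.2.val) := by simp only [mul_assoc]

omit [Fintype ι] [DecidableEq ι] in
/-- the three non-zero labels of distinct non-trivial involution pairs `(π₁, κ₁) ≠ (π₂, κ₂)` are non-trivial pairs -/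
lemma v4_label_ne_one {π₁ κ₁ π₂ κ₂ : Equiv.Perm ι} (hi₂ : π₂ ^ 2 = 1) (hi₂' : κ₂ ^ 2 = 1) (hne₁ : π₁ ≠ 1 ∨ κ₁ ≠ 1)
    (hne₂ : π₂ ≠ 1 ∨ κ₂ ≠ 1) (hne₁₂ : π₁ ≠ π₂ ∨ κ₁ ≠ κ₂) (g : ZMod 2 × ZMod 2) (hg : g ≠ 0) :
    π₁ ^ g.1.val * π₂ ^ g.2.val ≠ 1 ∨ κ₁ ^ g.1.val * κ₂ ^ g.2.val ≠ 1 := by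
  rcases v4_facts.2.2.2 g hg with ⟨ha, hb⟩ | ⟨ha, hb⟩ | ⟨ha, hb⟩ <;> rw [ha, hb]
  · simpa using hne₁
  · simpa using hne₂
  · simp only [pow_one]
    -- the product pair is non-trivial because the two pairs are distinct
    rcases hne₁₂ with h | h
    · left
      intro h1
      apply h
      calc π₁ = π₁ * (π₂ * π₂) := by rw [← pow_two, hi₂, mul_one]
        _ = (π₁ * π₂) * π₂ := by rw [mul_assoc]
        _ = π₂ := by rw [h1, one_mul]
    · right
      intro h1
      apply h
      calc κ₁ = κ₁ * (κ₂ * κ₂) := by rw [← pow_two, hi₂', mul_one]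
        _ = (κ₁ * κ₂) * κ₂ := by rw [mul_assoc]
        _ = κ₂ := by rw [h1, one_mul]

/-! ### index 4 ⇒ Williamson-type array -/

section main
variable {H : Matrix ι ι ℤ} (hH : IsHadamardMatrix H) (hι : Fintype.card ι = 668)
  {π κ : Equiv.Perm ι} {d e : ι → ℤ} (haut : IsSignedAut H π κ d e)
  (hπ : π ^ 167 = 1) (hκ : κ ^ 167 = 1) (hne : π ≠ 1 ∨ κ ≠ 1)
  {π₁ κ₁ π₂ κ₂ : Equiv.Perm ι} {d₁ e₁ d₂ e₂ : ι → ℤ}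
  (h₁ : IsSignedAut H π₁ κ₁ d₁ e₁) (h₂ : IsSignedAut H π₂ κ₂ d₂ e₂) (hc₁ : Commute π₁ π) (hc₁' : Commute κ₁ κ)
  (hc₂ : Commute π₂ π) (hc₂' : Commute κ₂ κ) (hi₁ : π₁ ^ 2 = 1) (hi₁' : κ₁ ^ 2 = 1) (hi₂ : π₂ ^ 2 = 1)
  (hi₂' : κ₂ ^ 2 = 1) (hne₁ : π₁ ≠ 1 ∨ κ₁ ≠ 1) (hne₂ : π₂ ≠ 1 ∨ κ₂ ≠ 1) (hne₁₂ : π₁ ≠ π₂ ∨ κ₁ ≠ κ₂)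
include hH hι haut hπ hκ hne h₁ h₂ hc₁ hc₁' hc₂ hc₂' hi₁ hi₁' hi₂ hi₂' hne₁ hne₂ hne₁₂

/-- **injectivity of the orbit labelling** `(g, s) ↦ π^s (P_g x₀)`, `P_g = π₁^{g₁} π₂^{g₂}` (row side). -/
lemma v4_orbitMap_injective (x₀ : ι) :
    Function.Injective (fun a : (ZMod 2 × ZMod 2) × ZMod 167 =>
      (π ^ a.2.val) ((π₁ ^ a.1.1.val * π₂ ^ a.1.2.val) x₀)) := by
  have p167 : Nat.Prime 167 := by norm_num
  have h167 := hadamard668_fixedRows_167 hH hι π κ d e haut hπ hκ hne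
  have hπfix : ∀ x, π x ≠ x := moved_of_card_fixed_eq_zero π h167.1
  obtain ⟨⟨hcomm, hcomm'⟩, -, -⟩ :=
    centralizer167_involutions_commute hH hι haut hπ hκ hne h₁ h₂ hc₁ hc₁' hc₂ hc₂' hi₁ hi₁' hi₂ hi₂'
  -- the signed automorphism attached to a label and its commutation with σ
  have hT : ∀ g : ZMod 2 × ZMod 2, ∃ D E : ι → ℤ, IsSignedAut H (π₁ ^ g.1.val * π₂ ^ g.2.val)
      (κ₁ ^ g.1.val * κ₂ ^ g.2.val) D E := fun g => ⟨_, _, isSignedAut_mul (isSignedAut_pow h₁ _) (isSignedAut_pow h₂ _)⟩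
  have hcR : ∀ g : ZMod 2 × ZMod 2, Commute (π₁ ^ g.1.val * π₂ ^ g.2.val) π :=
    fun g => (hc₁.pow_left _).mul_left (hc₂.pow_left _)
  have hcC : ∀ g : ZMod 2 × ZMod 2, Commute (κ₁ ^ g.1.val * κ₂ ^ g.2.val) κ :=
    fun g => (hc₁'.pow_left _).mul_left (hc₂'.pow_left _)
  rintro ⟨g, s⟩ ⟨h, t⟩ heq
  simp only at heq
  obtain ⟨Dg, Eg, hTg⟩ := hT g
  obtain ⟨Dh, Eh, hTh⟩ := hT h
  -- P_h x₀ lies in the π-orbit of P_g x₀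
  have hmem : (π₁ ^ h.1.val * π₂ ^ h.2.val) x₀ ∈ orbFin π 167 ((π₁ ^ g.1.val * π₂ ^ g.2.val) x₀) := by
    have e1 : (π₁ ^ h.1.val * π₂ ^ h.2.val) x₀ =
        (π ^ ((167 - t.val) + s.val)) ((π₁ ^ g.1.val * π₂ ^ g.2.val) x₀) := by
      rw [pow_add, Equiv.Perm.mul_apply (π ^ (167 - t.val)) (π ^ s.val), heq,
        ← Equiv.Perm.mul_apply (π ^ (167 - t.val)) (π ^ t.val), ← pow_add,
        Nat.sub_add_cancel (ZMod.val_lt t).le, hπ, Equiv.Perm.one_apply]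
    rw [e1]
    exact pow_apply_mem_orbFin π (by norm_num) hπ _ _
  obtain ⟨c, hcπ, hcκ⟩ := hadamard668_order167_centralizer_eq_of_sameOrbit hH hι haut hπ hκ hne hTg hTh (hcR g) (hcC g)
    (hcR h) (hcC h) hmem
  -- then P_{g+h} = π^c is an involution or trivial, hence trivial; so g + h = 0
  have hsq : ∀ k : ZMod 2 × ZMod 2, (π₁ ^ k.1.val * π₂ ^ k.2.val) ^ 2 = 1 ∧ (κ₁ ^ k.1.val * κ₂ ^ k.2.val) ^ 2 = 1 := by
    intro k
    constructor
    · rw [pow_two, ← v4_label_add hi₁ hi₂ hcomm, v4_facts.1 k]; simp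
    · rw [pow_two, ← v4_label_add hi₁' hi₂' hcomm', v4_facts.1 k]; simp
  have hgh : π₁ ^ (g + h).1.val * π₂ ^ (g + h).2.val = π ^ c ∧ κ₁ ^ (g + h).1.val * κ₂ ^ (g + h).2.val = κ ^ c := by
    constructor
    · rw [v4_label_add hi₁ hi₂ hcomm, hcπ, ← mul_assoc, ← pow_two, (hsq g).1, one_mul]
    · rw [v4_label_add hi₁' hi₂' hcomm', hcκ, ← mul_assoc, ← pow_two, (hsq g).2, one_mul]
  have hπc : π ^ c = 1 := by
    apply pow_eq_one_of_sq_pow_167 hπ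
    rw [mul_comm, pow_mul, ← hgh.1]; exact (hsq (g + h)).1
  have hκc : κ ^ c = 1 := by
    apply pow_eq_one_of_sq_pow_167 hκ
    rw [mul_comm, pow_mul, ← hgh.2]; exact (hsq (g + h)).2
  have hgh0 : g + h = 0 := by
    by_contra h0
    rcases v4_label_ne_one hi₂ hi₂' hne₁ hne₂ hne₁₂ (g + h) h0 with h' | h'
    · exact h' (hgh.1.trans hπc)
    · exact h' (hgh.2.trans hκc)
  have hg : g = h := v4_facts.2.2.1 g h hgh0
  subst hg
  -- same base point: the exponents agree
  have hst : s.val = t.val :=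
    perm_pow_apply_injective π p167 hπ (hπfix _) (ZMod.val_lt s) (ZMod.val_lt t) heq
  rw [Prod.mk.injEq]
  exact ⟨rfl, ZMod.val_injective 167 hst⟩

/-- **Index 4 ⇒ Williamson-type array.**  If two signed automorphisms with distinct non-trivial involution pairs commute
with the signed automorphism `σ` of pair order `167`, then `H` is equivalent to a Hadamard matrix
`M ((g,s),(h,t)) = θ g h · A (g + h) (t − s)` on `(ℤ/2 × ℤ/2) × ℤ/167`: a `V₄`-twisted `4 × 4` arrangement
`(A B C D / B A D C / C D A B / D C B A)` of four circulant `±1` blocks of order `167`, up to a `±1` sign table `θ`. -/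
theorem exists_williamsonTypeArray_of_centralizer_index_four :
    ∃ (θ : ZMod 2 × ZMod 2 → ZMod 2 × ZMod 2 → ℤ) (A : ZMod 2 × ZMod 2 → ZMod 167 → ℤ),
      (∀ g h, θ g h = 1 ∨ θ g h = -1) ∧ (∀ k r, A k r = 1 ∨ A k r = -1) ∧
      IsHadamardMatrix (Matrix.of fun (a b : (ZMod 2 × ZMod 2) × ZMod 167) => θ a.1 b.1 * A (a.1 + b.1) (b.2 - a.2)) ∧
      Fintype.card ((ZMod 2 × ZMod 2) × ZMod 167) = 668 := by
  have p167 : Nat.Prime 167 := by norm_num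
  have hcard : (Fintype.card ι : ℤ) ≠ 0 := by rw [hι]; norm_num
  obtain ⟨⟨hcomm, hcomm'⟩, -, -⟩ :=
    centralizer167_involutions_commute hH hι haut hπ hκ hne h₁ h₂ hc₁ hc₁' hc₂ hc₂' hi₁ hi₁' hi₂ hi₂'
  -- re-sign: σ is a permutation automorphism of H'
  obtain ⟨s, t, hs, ht, hH', hinv⟩ := exists_resign_of_odd hH haut (by decide : Odd 167) hπ hκ
  set H' : Matrix ι ι ℤ := Matrix.of fun i j => s i * t j * H i j with hH'def
  have hinv' : ∀ i j, H' (π i) (κ j) = H' i j := fun i j => by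
    simp only [hH'def, Matrix.of_apply]; exact hinv i j
  have hinvm : ∀ m i j, H' ((π ^ m) i) ((κ ^ m) j) = H' i j := perm_aut_pow hinv'
  have hH'ne : ∀ i j, H' i j ≠ 0 := fun i j => pm_ne_zero (hH'.1 i j)
  -- labels
  set P : ZMod 2 × ZMod 2 → Equiv.Perm ι := fun g => π₁ ^ g.1.val * π₂ ^ g.2.val with hPdef
  set Q : ZMod 2 × ZMod 2 → Equiv.Perm ι := fun g => κ₁ ^ g.1.val * κ₂ ^ g.2.val with hQdef
  set D' : ZMod 2 × ZMod 2 → ι → ℤ := fun g i =>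
    s (P g i) * s i * (cyc π₁ d₁ ((π₂ ^ g.2.val) i) g.1.val * cyc π₂ d₂ i g.2.val) with hD'def
  set E' : ZMod 2 × ZMod 2 → ι → ℤ := fun g j =>
    t (Q g j) * t j * (cyc κ₁ e₁ ((κ₂ ^ g.2.val) j) g.1.val * cyc κ₂ e₂ j g.2.val) with hE'def
  have hT' : ∀ g, IsSignedAut H' (P g) (Q g) (D' g) (E' g) :=
    fun g => signedAut_resign' hs ht (isSignedAut_mul (isSignedAut_pow h₁ g.1.val) (isSignedAut_pow h₂ g.2.val))
  have hcR : ∀ g, Commute (P g) π := fun g => (hc₁.pow_left _).mul_left (hc₂.pow_left _)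
  have hcC : ∀ g, Commute (Q g) κ := fun g => (hc₁'.pow_left _).mul_left (hc₂'.pow_left _)
  have hQadd : ∀ g h, Q (g + h) = Q g * Q h := fun g h => v4_label_add hi₁' hi₂' hcomm' g h
  obtain ⟨x₀⟩ : Nonempty ι := Fintype.card_pos_iff.mp (by rw [hι]; norm_num)
  set y₀ := x₀ with hy₀
  have hconst : ∀ g, (∀ k x, D' g ((π ^ k) x) = D' g x) ∧ (∀ k y, E' g ((κ ^ k) y) = E' g y) :=
    fun g => signs_const_of_commute hH'ne hinv' (by decide : Odd 167) hπ (hT' g) (hcR g) (hcC g) x₀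
  -- the bijections
  let fR : (ZMod 2 × ZMod 2) × ZMod 167 → ι := fun a => (π ^ a.2.val) (P a.1 x₀)
  let fC : (ZMod 2 × ZMod 2) × ZMod 167 → ι := fun b => (κ ^ b.2.val) (Q b.1 y₀)
  have hcardV : Fintype.card ((ZMod 2 × ZMod 2) × ZMod 167) = 668 := by simp [ZMod.card]
  have hbR : Function.Bijective fR := by
    rw [Fintype.bijective_iff_injective_and_card]
    exact ⟨v4_orbitMap_injective hH hι haut hπ hκ hne h₁ h₂ hc₁ hc₁' hc₂ hc₂' hi₁ hi₁' hi₂ hi₂' hne₁ hne₂ hne₁₂ x₀,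
      by rw [hcardV, hι]⟩
  have hbC : Function.Bijective fC := by
    rw [Fintype.bijective_iff_injective_and_card]
    refine ⟨?_, by rw [hcardV, hι]⟩
    -- the column side is the row side of the transposed matrix
    have hT := isHadamard_transpose hH hcard
    exact v4_orbitMap_injective hT hι (isSignedAut_transpose haut) hκ hπ hne.symm (isSignedAut_transpose h₁)
      (isSignedAut_transpose h₂) hc₁' hc₁ hc₂' hc₂ hi₁' hi₁ hi₂' hi₂ hne₁.symm hne₂.symm hne₁₂.symm y₀
  let ER : (ZMod 2 × ZMod 2) × ZMod 167 ≃ ι := Equiv.ofBijective fR hbR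
  let EC : (ZMod 2 × ZMod 2) × ZMod 167 ≃ ι := Equiv.ofBijective fC hbC
  -- the data
  refine ⟨fun g h => D' g x₀ * E' g (Q (g + h) y₀), fun k r => H' x₀ ((κ ^ r.val) (Q k y₀)), ?_, fun k r => hH'.1 _ _,
    ?_, hcardV⟩
  · intro g h
    rcases (hT' g).1 x₀ with h1 | h1 <;> rcases (hT' g).2.1 (Q (g + h) y₀) with h2 | h2 <;> simp [h1, h2]
  -- the array is the reindexed H'
  have hentry : ∀ a b : (ZMod 2 × ZMod 2) × ZMod 167,
      D' a.1 x₀ * E' a.1 (Q (a.1 + b.1) y₀) * H' x₀ ((κ ^ (b.2 - a.2).val) (Q (a.1 + b.1) y₀)) = H' (ER a) (EC b) := by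
    rintro ⟨g, s'⟩ ⟨h, t'⟩
    show D' g x₀ * E' g (Q (g + h) y₀) * H' x₀ ((κ ^ (t' - s').val) (Q (g + h) y₀)) =
      H' ((π ^ s'.val) (P g x₀)) ((κ ^ t'.val) (Q h y₀))
    -- Q_h = Q_g Q_{g+h}; pull P_g, Q_g through the powers of σ
    have hQh : Q h = Q g * Q (g + h) := by rw [← hQadd, v4_facts.2.1]
    have e1 : (κ ^ t'.val) (Q h y₀) = Q g ((κ ^ t'.val) (Q (g + h) y₀)) := by
      rw [hQh, Equiv.Perm.mul_apply (Q g) (Q (g + h)), ← Equiv.Perm.mul_apply (κ ^ t'.val) (Q g),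
        ← ((hcC g).pow_right t'.val).eq, Equiv.Perm.mul_apply]
    have e2 : (π ^ s'.val) (P g x₀) = P g ((π ^ s'.val) x₀) := by
      rw [← Equiv.Perm.mul_apply, ← ((hcR g).pow_right s'.val).eq, Equiv.Perm.mul_apply]
    rw [e1, e2, (hT' g).2.2, (hconst g).1, (hconst g).2]
    -- H'(π^s x₀, κ^t z) = H'(x₀, κ^(t-s) z)
    have e3 : (κ ^ t'.val) (Q (g + h) y₀) = (κ ^ s'.val) ((κ ^ (t' - s').val) (Q (g + h) y₀)) := by
      rw [← Equiv.Perm.mul_apply (κ ^ s'.val) (κ ^ (t' - s').val), ← pow_add,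
        ← pow_mod_of_pow_eq_one κ hκ (s'.val + (t' - s').val), ← ZMod.val_add, add_sub_cancel]
    rw [e3, hinvm]
  have hM : (Matrix.of fun (a b : (ZMod 2 × ZMod 2) × ZMod 167) =>
      D' a.1 x₀ * E' a.1 (Q (a.1 + b.1) y₀) * H' x₀ ((κ ^ (b.2 - a.2).val) (Q (a.1 + b.1) y₀))) = H'.submatrix ER EC := by
    ext a b
    rw [Matrix.of_apply, Matrix.submatrix_apply, hentry]
  rw [hM]
  refine ⟨fun a b => hH'.1 _ _, ?_⟩
  rw [Matrix.transpose_submatrix, Matrix.submatrix_mul_equiv, hH'.2]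
  ext a b
  rw [Matrix.submatrix_apply, Matrix.smul_apply, Matrix.one_apply, Matrix.smul_apply, Matrix.one_apply, hι]
  simp only [EmbeddingLike.apply_eq_iff_eq]
  simp [ZMod.card]

end main

end Summit.Ventures.DiscreteObjects.Hadamard
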